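import Summits.Ventures.Crystal3D.Bulk.GapReduction
import HarnessLib

/-!
# The closest known intruder: GAP(`d₀`) is FALSE for `d₀ > 7√3/9` (an exact fourteen-ball packing)

HONEST FRAMING. Part of the venture `Summits/Ventures/Crystal3D` (cell `pub-crystal3d`, phase 2,
`PLAN.md` R41; seat typer-bulk-2, on the red team's recommendation R-12). This file pins the window
of the cell's census target `GapTupleDiam d₀` (`Bulk/GapReduction.lean`) FROM ABOVE by an explicit,
exactly checked configuration found independently by the seats theory-1 (`SCORE-DESIGN.md` §2,
cos² of the hole radius `= 49/108`), engine-5 (`DESIGN-L12.md`) and idea-2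
(`phase2/idea2/DSTAR-INTRUDER.md`, the "five-fold twin channel"): a unit-diameter ball `O` kissed by
twelve unit-diameter balls — two on the axis `E±`, two `B±`, four `F`, four `H`, with `23`
contacts among them — and a fourteenth ball `Q` of the same packing at distance
`7√3/9 = 1.3471…` from `O`, touching exactly the four `H`. In coordinates (diameter-one units)
every centre is `(a, b√6, c√3)/18` with INTEGER `a, b, c`, so `324 ·` every squared distance is
the integer `(a - a')² + 6 (b - b')² + 3 (c - c')²`; all `91` pairs are checked by `decide` over `ℤ`
and transported to `ℝ³` through `√6² = 6`, `√3² = 3` — nothing numerical enters.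

Consequences (kernel theorems, unconditional): `¬ GapTupleDiam d₀` for every `d₀ > 7√3/9`,
`¬ GapTuple δ` for every `δ > 14√3/9 = 2.6943…` (radius-one units), in particular for
`d₀ ≥ 1.3472` / `δ ≥ 2.6944`. Together with the tree's `gapTuple_of_L12`
(`flyspeck_L12 → GapTuple 2.52`) this brackets the true gap constant of a twelve-kissed ball in
`[2.52, 14√3/9]` (conditionally on `flyspeck_L12` from below; `2.51838585` is Böröczky–Szabó's
printed Flyspeck-free value). Whether `14√3/9` IS the constant (idea-2's conjecture HOLE-12) is NOT
claimed.
-/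

noncomputable section

open scoped BigOperators
open Finset

namespace Summit.Ventures.Crystal3D

namespace Intruder

/-- Integer coefficient triples `(a, b, c)` of the fourteen centres `(a, b√6, c√3)/18`
(diameter-one units): index `0` the kissed ball `O = 0`; `1, 2` the axis balls `E± = (±1, 0, 0)`;
`3, 4` the balls `B± = (±1/2, 0, -√3/2)`; `5–8` the four `F = (±1/2, ±√6/3, -√3/6)`; `9–12` the
four `H = (±1/2, ±2√6/9, 7√3/18)`; `13` the intruder `Q = (0, 0, 7√3/9)`. -/
def coeff : Fin 14 → Fin 3 → ℤ :=
  ![![0, 0, 0],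
    ![18, 0, 0], ![-18, 0, 0],
    ![9, 0, -9], ![-9, 0, -9],
    ![9, 6, -3], ![9, -6, -3], ![-9, 6, -3], ![-9, -6, -3],
    ![9, 4, 7], ![9, -4, 7], ![-9, 4, 7], ![-9, -4, 7],
    ![0, 0, 14]]

/-- The integer quadratic form giving `324 ·` the squared distance of two centres in terms of
their coefficient triples: `(a - a')² + 6 (b - b')² + 3 (c - c')²`. -/
def qf (v w : Fin 3 → ℤ) : ℤ :=
  (v 0 - w 0) ^ 2 + 6 * (v 1 - w 1) ^ 2 + 3 * (v 2 - w 2) ^ 2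

/-- All `91` pairs of distinct centres are at squared distance `≥ 1`, i.e. `qf ≥ 324` (a packing
of unit-diameter balls). Integer arithmetic checked by `decide`. -/
theorem le_qf : ∀ i j : Fin 14, i ≠ j → 324 ≤ qf (coeff i) (coeff j) := by
  decide

/-- The twelve balls `1, …, 12` touch the ball `0` (`qf = 324`, squared distance exactly `1`). -/
theorem qf_eq : ∀ i : Fin 14, i ≠ 0 → i ≠ 13 → qf (coeff i) (coeff 0) = 324 := by
  decide

/-- The intruder `13` has `qf = 588` to the ball `0`: squared distance `588/324 = 49/27`. -/
theorem qf_zero_thirteen : qf (coeff 0) (coeff 13) = 588 := by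
  decide

/-- The intruder touches the four `H` balls — it is a genuine member of the packing. -/
theorem qf_thirteen_H :
    ∀ i : Fin 14, 9 ≤ (i : ℕ) → (i : ℕ) ≤ 12 → qf (coeff 13) (coeff i) = 324 := by
  decide

/-- There are exactly `39` contacts among the fourteen balls (`12` with `O`, `23` in the shell,
`4` with `Q`), counted here as `78` ordered pairs. -/
theorem card_contacts :
    ((univ ×ˢ univ).filter
      fun p : Fin 14 × Fin 14 => p.1 ≠ p.2 ∧ qf (coeff p.1) (coeff p.2) = 324).card = 78 := by
  decide

/-- The fourteen centres in `ℝ³`: coefficient triple `(a, b, c) ↦ (a, b√6, c√3)/18`. -/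
def pt (i : Fin 14) : EuclideanSpace ℝ (Fin 3) :=
  WithLp.toLp 2 fun k => (coeff i k : ℝ) * ![1, Real.sqrt 6, Real.sqrt 3] k / 18

/-- Coordinates of the centres. -/
theorem pt_apply (i : Fin 14) (k : Fin 3) :
    pt i k = (coeff i k : ℝ) * ![1, Real.sqrt 6, Real.sqrt 3] k / 18 := rfl

/-- **Squared distances are the integer quadratic form over `324`.** -/
theorem dist_pt_sq (i j : Fin 14) :
    dist (pt i) (pt j) ^ 2 = (qf (coeff i) (coeff j) : ℝ) / 324 := by
  have h6 : Real.sqrt 6 ^ 2 = 6 := Real.sq_sqrt (by norm_num)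
  have h3 : Real.sqrt 3 ^ 2 = 3 := Real.sq_sqrt (by norm_num)
  rw [EuclideanSpace.dist_eq, Real.sq_sqrt (Finset.sum_nonneg fun k _ => sq_nonneg _),
    Fin.sum_univ_three]
  simp only [pt_apply, qf, Real.dist_eq, sq_abs, Matrix.cons_val_zero, Matrix.cons_val_one,
    Matrix.cons_val_two, Matrix.head_cons, Matrix.tail_cons]
  push_cast
  have e1 : ∀ a b : ℝ, (a * Real.sqrt 6 / 18 - b * Real.sqrt 6 / 18) ^ 2 =
      6 * (a - b) ^ 2 / 324 := fun a b => by
    rw [← sub_div, ← sub_mul, div_pow, mul_pow, h6]; ring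
  have e2 : ∀ a b : ℝ, (a * Real.sqrt 3 / 18 - b * Real.sqrt 3 / 18) ^ 2 =
      3 * (a - b) ^ 2 / 324 := fun a b => by
    rw [← sub_div, ← sub_mul, div_pow, mul_pow, h3]; ring
  rw [e1, e2]
  ring

/-- Distinct balls of the configuration are at distance `≥ 1`. -/
theorem one_le_dist_pt {i j : Fin 14} (hij : i ≠ j) : (1 : ℝ) ≤ dist (pt i) (pt j) := by
  have h : (1 : ℝ) ≤ dist (pt i) (pt j) ^ 2 := by
    rw [dist_pt_sq, le_div_iff₀ (by norm_num : (0 : ℝ) < 324)]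
    exact_mod_cast le_qf i j hij
  nlinarith [dist_nonneg (x := pt i) (y := pt j)]

/-- The twelve shell balls touch the centre. -/
theorem dist_pt_zero {i : Fin 14} (hi0 : i ≠ 0) (hi13 : i ≠ 13) : dist (pt i) (pt 0) = 1 := by
  have h : dist (pt i) (pt 0) ^ 2 = 1 := by
    rw [dist_pt_sq, div_eq_one_iff_eq (by norm_num : (324 : ℝ) ≠ 0)]
    exact_mod_cast qf_eq i hi0 hi13
  nlinarith [dist_nonneg (x := pt i) (y := pt 0)]

/-- `(7√3/9)² = 49/27`. -/
theorem seven_sqrt_three_div_nine_sq : (7 * Real.sqrt 3 / 9) ^ 2 = 49 / 27 := by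
  have h3 : Real.sqrt 3 ^ 2 = 3 := Real.sq_sqrt (by norm_num)
  nlinarith [h3]

/-- The intruder is at distance exactly `7√3/9` from the centre. -/
theorem dist_pt_zero_thirteen : dist (pt 0) (pt 13) = 7 * Real.sqrt 3 / 9 := by
  have h : dist (pt 0) (pt 13) ^ 2 = (7 * Real.sqrt 3 / 9) ^ 2 := by
    rw [dist_pt_sq, seven_sqrt_three_div_nine_sq, qf_zero_thirteen]
    norm_num
  have hpos : 0 ≤ 7 * Real.sqrt 3 / 9 := by positivity
  have hd : 0 ≤ dist (pt 0) (pt 13) := dist_nonneg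
  nlinarith [h, hpos, hd, sq_nonneg (dist (pt 0) (pt 13) - 7 * Real.sqrt 3 / 9),
    sq_nonneg (dist (pt 0) (pt 13) + 7 * Real.sqrt 3 / 9)]

/-- Numerical size of the intruder distance: `1.3471 < 7√3/9 < 1.3472` (diameter-one units). -/
theorem seven_sqrt_three_div_nine_bounds :
    (1.3471 : ℝ) < 7 * Real.sqrt 3 / 9 ∧ 7 * Real.sqrt 3 / 9 < 1.3472 := by
  have h3 : Real.sqrt 3 ^ 2 = 3 := Real.sq_sqrt (by norm_num)
  have hpos : 0 ≤ Real.sqrt 3 := Real.sqrt_nonneg 3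
  constructor <;> nlinarith [h3, hpos]

end Intruder

open Intruder

/-- **The exact fourteen-ball configuration** (cell files `SCORE-DESIGN.md` §2,
`phase2/idea2/DSTAR-INTRUDER.md` §1): fourteen centres of unit-diameter balls pairwise at distance
`≥ 1`, twelve of them touching the first, the fourteenth at distance exactly `7√3/9 = 1.3471…`
from it. -/
theorem exists_twelve_kissed_with_intruder :
    ∃ c : Fin 14 → EuclideanSpace ℝ (Fin 3),
      (∀ i j : Fin 14, i ≠ j → (1 : ℝ) ≤ dist (c i) (c j)) ∧
      (∀ i : Fin 14, i ≠ 0 → i ≠ 13 → dist (c i) (c 0) = 1) ∧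
      dist (c 0) (c 13) = 7 * Real.sqrt 3 / 9 :=
  ⟨pt, fun _ _ hij => one_le_dist_pt hij, fun _ hi0 hi13 => dist_pt_zero hi0 hi13,
    dist_pt_zero_thirteen⟩

/-- **GAP(`d₀`) is false for `d₀ > 7√3/9`** (diameter-one fourteen-ball form of
`Bulk/GapReduction.lean`): no census can certify `GapTupleDiam d₀` above `7√3/9 = 1.3471…`. -/
theorem not_gapTupleDiam_of_lt {d₀ : ℝ} (h : 7 * Real.sqrt 3 / 9 < d₀) : ¬ GapTupleDiam d₀ := by
  intro hg
  have := hg pt (fun _ _ hij => one_le_dist_pt hij) (fun _ hi0 hi13 => dist_pt_zero hi0 hi13)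
  rw [dist_pt_zero_thirteen] at this
  linarith

/-- In particular `¬ GapTupleDiam 1.3472`. -/
theorem not_gapTupleDiam_13472 : ¬ GapTupleDiam 1.3472 :=
  not_gapTupleDiam_of_lt seven_sqrt_three_div_nine_bounds.2

/-- **GAP(`δ`) is false for `δ > 14√3/9 = 2.6943…`** in Hales's radius-one units (the
fourteen-ball form `GapTuple`; compare `gapTuple_of_L12 : flyspeck_L12 → GapTuple 2.52`). -/
theorem not_gapTuple_of_lt {δ : ℝ} (h : 14 * Real.sqrt 3 / 9 < δ) : ¬ GapTuple δ := by
  intro hg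
  have h' : GapTuple (2 * (δ / 2)) := by rwa [mul_div_cancel₀ δ two_ne_zero]
  exact not_gapTupleDiam_of_lt (d₀ := δ / 2) (by linarith) ((gapTupleDiam_iff (δ / 2)).2 h')

/-- In particular `¬ GapTuple 2.6944`, while `GapTuple 2.52` holds under `flyspeck_L12`. -/
theorem not_gapTuple_26944 : ¬ GapTuple 2.6944 :=
  not_gapTuple_of_lt (by linarith [seven_sqrt_three_div_nine_bounds.2])

end Summit.Ventures.Crystal3D

end
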